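import Summits.CriticalPhenomena.PercolationContinuityZ3.Theorems.PercNearOneGluingNoHeavyLowerTailAntitheticOneSumShift
import Summits.CriticalPhenomena.PercolationContinuityZ3.Theorems.PercNearOneGluingNoHeavyLowerTailAntitheticHandlePrincipleShift
import HarnessLib

/-!
# `NoHeavyLowerTail` (stmt-CriticalPhenomena-4575) — antithetic cluster pairs: the **DUAL HANDLE THEOREM WITH SHIFTED-BIC HYPOTHESES** —
# Δ2 for `K` + a handle at `(P, Q)` from (⊕)_shift of `(K, s, P)` and (M)_shift of `(K; P, Q)` alone (the `𝒮_shift` re-base of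
# …AntitheticHandleDual; prim-hp-2 gen 65, HOME/MEMO-gen65.md §2(d), §5 (P3))

Support file (`--supports stmt-CriticalPhenomena-4575`, hull-port prover `prim-hp-2`, gen 65).  No definitions, no named facts, no sorries;
standard axioms.  Setting of …AntitheticHandleDual.  `𝒮_shift = {K(X,Y) = F⁺(X) − F⁻(Y) : F⁻ ≤ F⁺ monotone}`; "(⊕)_shift of (E, s, P)" means
`Σ_{T : P ∈ X_E} (F⁺(X) − F⁻(Y))(G⁺(X) − G⁻(Y)) ≥ 0` for all monotone `F⁻ ≤ F⁺`, `G⁻ ≤ G⁺`; "(M)_shift" the same over `{P ∈ X, Q ∉ Y}`.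
* `Antithetic.Pendant.oplus_stub_of_oplus_shift` — (⊕)_shift survives the pendant stub (1-sum; …AntitheticOneSumShift).
* `Antithetic.Pendant.handle_vertex_sum_nonneg_of_oplus_shift` — **DUAL HANDLE THEOREM (𝒮_shift)**: `K` loop-free through `s`, `P, Q`
  vertices; (⊕)_shift of `(E₀, s, P)` and (M)_shift of `(E₀; P, Q)` ⇒ for all arm lengths and all monotone `F, G` the vertex antithetic
  inequality at `R = {x}` for `K ∪ arms + xy + xz`.  The hypotheses are STRICTLY WEAKER than those of the 𝒮-version (`𝒮_shift ⊂ 𝒮`;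
  `K_{2,4}` from a pole satisfies (⊕)_shift exactly — kit j285856 — but not (⊕) over 𝒮 — …AntitheticK24NotOplus), the conclusion identical.
  Every existing 𝒮-input (boxes, pair-cube certificates, comparability, apex lemmas) is a fortiori an 𝒮_shift-input.
[cite: VandenbergHaggstromKahn2005, §1 p. 6 ("Harris' inequality"), §1 p. 3 (open cluster `C_s`)]
-/

noncomputable section

namespace Summit.CriticalPhenomena.PercolationContinuityZ3.Theorems

open Literature.Probability.Percolation
open scoped Classical

namespace Antithetic

namespace Pendant

variable {V : Type*} [Fintype V] {E₀ : Set (Sym2 V)} {s P : V} {w : ℕ → V} {b : ℕ}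
  (hnd : ∀ f ∈ E₀, ¬ f.IsDiag)
  (hwfresh : ∀ i, 0 < i → i ≤ b → ∀ f ∈ E₀, w i ∈ f → f.IsDiag)
  (hwinj : ∀ i j, i ≤ b → j ≤ b → w i = w j → i = j)
  (hsw : ∀ i, 0 < i → i ≤ b → s ≠ w i) (hPw : ∀ i, 0 < i → i ≤ b → P ≠ w i)
  (hoplus : ∀ Fp Fm Gp Gm : Set V → ℝ, Monotone Fp → Monotone Fm → (∀ S, Fm S ≤ Fp S) →
    Monotone Gp → Monotone Gm → (∀ S, Gm S ≤ Gp S) →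
    0 ≤ ∑ T ∈ Finset.univ.filter (fun T : Set (Sym2 V) => P ∈ openCluster (T ∩ E₀) s),
      (Fp (openCluster (T ∩ E₀) s) - Fm (openCluster (Tᶜ ∩ E₀) s)) * (Gp (openCluster (T ∩ E₀) s) - Gm (openCluster (Tᶜ ∩ E₀) s)))
include hnd hwfresh hwinj hsw hPw hoplus

omit hwinj in
/-- **(⊕) along the stub from (⊕) of `K`.**  If `(E₀, s, P)` is ⊕-positive then so is `(stub_j ∪ E₀, s, P)` for the pendant stub
`w 0, …, w j` of fresh vertices (`j ≤ b`): a 1-sum at `w 0`.  (The edge set is written `stub_j ∪ E₀`; `oplus_stub_of_boxes` concludes the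
same for `E₀ ∪ stub_j` from a box partition — here the hypothesis is ⊕-positivity of `K` alone.) [this work] -/
theorem oplus_stub_of_oplus_shift {j : ℕ} (hj : j ≤ b) (Fp Fm Gp Gm : Set V → ℝ) (hFp : Monotone Fp) (hFm : Monotone Fm)
    (hF : ∀ S, Fm S ≤ Fp S) (hGp : Monotone Gp) (hGm : Monotone Gm) (hG : ∀ S, Gm S ≤ Gp S) :
    0 ≤ ∑ T ∈ Finset.univ.filter (fun T : Set (Sym2 V) => P ∈ openCluster (T ∩ (Cyc.edgeSet j w ∪ E₀)) s),
      (Fp (openCluster (T ∩ (Cyc.edgeSet j w ∪ E₀)) s) - Fm (openCluster (Tᶜ ∩ (Cyc.edgeSet j w ∪ E₀)) s)) *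
        (Gp (openCluster (T ∩ (Cyc.edgeSet j w ∪ E₀)) s) - Gm (openCluster (Tᶜ ∩ (Cyc.edgeSet j w ∪ E₀)) s)) := by
  rw [Set.union_comm]
  -- a fresh stub vertex `w k` (`1 ≤ k ≤ b`) lies on no pair of `E₀`
  have hfresh' : ∀ k, 0 < k → k ≤ b → ∀ f ∈ E₀, w k ∉ f := fun k hk hkb f hf hw => hnd f hf (hwfresh k hk hkb f hf hw)
  -- the entries of a stub pair
  have hends : ∀ e ∈ Cyc.edgeSet j w, ∀ v : V, v ∈ e → v = w 0 ∨ ∃ k, 0 < k ∧ k ≤ b ∧ v = w k := by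
    rintro e ⟨i, hi, rfl⟩ v hv
    rw [Cyc.edge] at hv
    rcases Sym2.mem_iff.1 hv with rfl | rfl
    · by_cases hi0 : i = 0
      · exact Or.inl (by rw [hi0])
      · exact Or.inr ⟨i, Nat.pos_of_ne_zero hi0, by omega, rfl⟩
    · exact Or.inr ⟨i + 1, Nat.succ_pos i, by omega, rfl⟩
  have hsep : ∀ e₁ ∈ E₀, ∀ e₂ ∈ Cyc.edgeSet j w, ∀ v : V, v ∈ e₁ → v ∈ e₂ → v = w 0 := by
    intro e₁ he₁ e₂ he₂ v hv₁ hv₂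
    rcases hends e₂ he₂ v hv₂ with h | ⟨k, hk, hkb, rfl⟩
    · exact h
    · exact absurd hv₁ (hfresh' k hk hkb e₁ he₁)
  have hs : ∀ e ∈ Cyc.edgeSet j w, s ∈ e → s = w 0 := by
    intro e he hse
    rcases hends e he s hse with h | ⟨k, hk, hkb, h⟩
    · exact h
    · exact absurd h (hsw k hk hkb)
  have hP : ∀ e ∈ Cyc.edgeSet j w, P ∈ e → P = w 0 := by
    intro e he hPe
    rcases hends e he P hPe with h | ⟨k, hk, hkb, h⟩
    · exact h
    · exact absurd h (hPw k hk hkb)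
  have hdis : Disjoint E₀ (Cyc.edgeSet j w) := by
    rw [Set.disjoint_left]
    rintro e he ⟨i, hi, rfl⟩
    exact hfresh' (i + 1) (Nat.succ_pos i) (by omega) _ he (by rw [Cyc.edge]; exact Sym2.mem_mk_right _ _)
  -- the event `P ∈ X` is the same for `E₀` and `E₀ ∪ stub` (`P` on the `E₀` side); then the 1-sum lemma in `𝒮_shift`
  have hev : ∀ ω : Set (Sym2 V), P ∈ openCluster (ω ∩ (E₀ ∪ Cyc.edgeSet j w)) s ↔ P ∈ openCluster (ω ∩ E₀) s :=
    fun ω => Glue.reach_side_one s hsep hs hP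
  have hfilter : Finset.univ.filter (fun ω : Set (Sym2 V) => P ∈ openCluster (ω ∩ (E₀ ∪ Cyc.edgeSet j w)) s) =
      Finset.univ.filter (fun ω : Set (Sym2 V) => P ∈ openCluster (ω ∩ E₀) s) :=
    Finset.filter_congr fun ω _ => hev ω
  rw [hfilter]
  refine OneSumShift.event_sum_nonneg hsep hs hdis (fun ω => P ∈ openCluster (ω ∩ E₀) s) ?_ hoplus hFp hFm hF hGp hGm hG
  intro ω ω' h
  show P ∈ openCluster (ω ∩ E₀) s ↔ P ∈ openCluster (ω' ∩ E₀) s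
  rw [h]

variable {u : ℕ → V} {a : ℕ} {Q : V} (hu0 : u 0 = P) (hw0 : w 0 = Q)
  (hufresh : ∀ i, 0 < i → i ≤ a → ∀ f ∈ E₀ ∪ Cyc.edgeSet b w, u i ∈ f → f.IsDiag)
  (huinj : ∀ i j, i ≤ a → j ≤ a → u i = u j → i = j)
  (hsu : ∀ i, 0 < i → i ≤ a → s ≠ u i) (hzu : ∀ i, 0 < i → i ≤ a → w b ≠ u i)
  (hmixed : ∀ Fp Fm Gp Gm : Set V → ℝ, Monotone Fp → Monotone Fm → (∀ S, Fm S ≤ Fp S) →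
    Monotone Gp → Monotone Gm → (∀ S, Gm S ≤ Gp S) →
    0 ≤ ∑ T ∈ Finset.univ.filter (fun T : Set (Sym2 V) => P ∈ openCluster (T ∩ E₀) s ∧ Q ∉ openCluster (Tᶜ ∩ E₀) s),
      (Fp (openCluster (T ∩ E₀) s) - Fm (openCluster (Tᶜ ∩ E₀) s)) * (Gp (openCluster (T ∩ E₀) s) - Gm (openCluster (Tᶜ ∩ E₀) s)))
include hu0 hw0 hufresh huinj hsu hzu hmixed

/-- **DUAL HANDLE THEOREM with shifted-BIC hypotheses.**  `K` any loop-free finite graph (edge set `E₀`) through `s`; `P, Q` vertices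
of `K`; arms `u 0 = P, …, u a = y` and `w 0 = Q, …, w b = z` of fresh vertices (`a, b ≥ 0`); `x` fresh, joined to `y` and `z`; `yz` not a
pair of `H = K ∪ arms`; `E = H + xy + xz`.  If (⊕)_shift holds for `(E₀, s, P)` and (M)_shift for `(E₀; P, Q)`, then for all monotone
`F, G`: `0 ≤ Σ_{ω : ¬(x ∈ X_E ω ∧ x ∈ Y_E ω)} (F(X_E ω) − F(Y_E ω))·(G(X_E ω) − G(Y_E ω))`. [this work] -/
theorem handle_vertex_sum_nonneg_of_oplus_shift {x : V}
    (hx : ∀ f ∈ Cyc.edgeSet b w ∪ (Cyc.edgeSet a u ∪ E₀), x ∈ f → f.IsDiag)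
    (hxs : x ≠ s) (hxy : x ≠ u a) (hxz : x ≠ w b) (hyz : u a ≠ w b) (hg : s(u a, w b) ∉ Cyc.edgeSet b w ∪ (Cyc.edgeSet a u ∪ E₀))
    {F G : Set V → ℝ} (hF : Monotone F) (hG : Monotone G) :
    0 ≤ ∑ ω ∈ Finset.univ.filter (fun ω : Set (Sym2 V) =>
        ¬ ((openGraph (ω ∩ insert s(x, u a) (insert s(x, w b) (Cyc.edgeSet b w ∪ (Cyc.edgeSet a u ∪ E₀))))).Reachable s x ∧
          (openGraph (ωᶜ ∩ insert s(x, u a) (insert s(x, w b) (Cyc.edgeSet b w ∪ (Cyc.edgeSet a u ∪ E₀))))).Reachable s x)),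
      (F (openCluster (ω ∩ insert s(x, u a) (insert s(x, w b) (Cyc.edgeSet b w ∪ (Cyc.edgeSet a u ∪ E₀)))) s) -
          F (openCluster (ωᶜ ∩ insert s(x, u a) (insert s(x, w b) (Cyc.edgeSet b w ∪ (Cyc.edgeSet a u ∪ E₀)))) s)) *
        (G (openCluster (ω ∩ insert s(x, u a) (insert s(x, w b) (Cyc.edgeSet b w ∪ (Cyc.edgeSet a u ∪ E₀)))) s) -
          G (openCluster (ωᶜ ∩ insert s(x, u a) (insert s(x, w b) (Cyc.edgeSet b w ∪ (Cyc.edgeSet a u ∪ E₀)))) s)) := by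
  -- (the statement writes the edge set of `H` as `stub ∪ (arm ∪ E₀)`, the shifted handle principle as `(arm ∪ E₀) ∪ stub`: the same set;
  -- the bracketing differs from …HandleDual / …HandlePrinciple / …HandleOplus so that no two conclusions are syntactic duplicates)
  have hcomm : Cyc.edgeSet b w ∪ (Cyc.edgeSet a u ∪ E₀) = (Cyc.edgeSet a u ∪ E₀) ∪ Cyc.edgeSet b w := Set.union_comm _ _
  rw [hcomm] at hx hg ⊢
  refine handle_vertex_sum_nonneg_of_shift hu0 hw0 hufresh hwfresh huinj hwinj hsu hsw hPw hzu ?_ hmixed hnd hx hxs hxy hxz hyz hg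
    hF hG
  intro j hj Fp Fm Gp Gm hFp hFm hF' hGp hGm hG'
  have h := oplus_stub_of_oplus_shift hnd hwfresh hsw hPw hoplus hj.le Fp Fm Gp Gm hFp hFm hF' hGp hGm hG'
  rw [Set.union_comm] at h
  exact h

end Pendant

end Antithetic

end Summit.CriticalPhenomena.PercolationContinuityZ3.Theorems
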